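import Summits.KontsevichZagierPeriods.KontsevichZagierPeriods.Theorems.LinRedNormalFormArrangementNormalFormStubRebaseSimplePosOneFibreResidualSub
import Summits.KontsevichZagierPeriods.KontsevichZagierPeriods.Theorems.LinRedNormalFormArrangementNormalFormStubRebaseSimplePosOneFibreSwapForms

/-!
# Stub `stub_rebaseSimplePosOne` (crux `ArrangementNormalForm`, line `janus-bands`, v6.2) —
part `Walls`: the pre-cut of a corner band by the walls `κ = ±Φ`

A band above its apex level `κ` (letter `0`, transverse bounds `u < v`, `u − κ = A (v − u)`,
`A > 0`) has two degenerations at a corner (apex on the letter, `κ = u = v = 0` at a boundary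
point of the base cell): the apex level `κ(x')` vanishes, and possibly ALSO the `y`-free form
`Φ(x') := (v − u)(x', ℓ₂(x'))` (the pole `y = ℓ₂(x')` of the base factor passes through the
apex). `RebasePos.good_of_walls` cuts the base cell by the two rational walls `κ = Φ`, `κ = −Φ`
(rule 1a; degenerate walls are skipped): on the pieces with `|Φ| ≤ |κ|` every corner is a
DOUBLE corner — `κ = 0` forces `Φ = 0`, i.e. `y = ℓ₂(x')` at the corner
(`RebasePos.good_thick_le`, `RebasePos.good_far_le`: double-corner hypothesis or, without
corner, `rebaseSimplePos_thickBand` by compactness); the pieces with `|κ| < |Φ|` are handed to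
the coordinate swap `y ↔ t` (part `SwapBand`), after which the roles of `κ` and `Φ` are
exchanged. Registered as `rebaseSimplePos_goodOfWalls`.

References: M. Kontsevich, D. Zagier, *Periods* (2001), §1.2, rule (1a).
-/

noncomputable section

open Set MeasureTheory MvPolynomial
open Literature.NumberTheory.Transcendental Literature.ModelTheory.ExponentialFields

namespace Summit.KontsevichZagierPeriods.ArrangementNormalForm.JanusBands

namespace RebasePos

open SeparatePos

section Walls

variable {B m m' : ℕ}

/-- `affF` of a sum of forms. -/
theorem affF_addW {K : ℕ} (h h' : (Fin (B + 1) → ℚ) × ℚ) (z : Fin (B + 1 + K) → ℝ) :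
    affF B K (h + h') z = affF B K h z + affF B K h' z := by
  simp only [affF, Prod.fst_add, Prod.snd_add, Pi.add_apply, Rat.cast_add, add_mul,
    Finset.sum_add_distrib]
  ring

/-- **The pre-cut by the walls `κ = ±Φ`** (rule 1a). A representation with literal domain
`{rows, u < t < v}` is good as soon as its sub-cells (extra rows) on which `|Φ| ≤ |κ|` (`hA`)
and those on which `|κ| < |Φ|` (`hB`) are. -/
theorem good_of_walls {S : Set KZ.FormalRep} (s : KZ.IntegralRep (B + 1 + 1))
    (M : Fin m' → (Fin (B + 1) → ℚ) × ℚ) (u v κ Φ : (Fin (B + 1) → ℚ) × ℚ)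
    (hdom : s.domain = gDom B 1 m' M (fun _ => Sum.inr u) (fun _ => Sum.inr v))
    (hA : ∀ (m₁ : ℕ) (s₁ : KZ.IntegralRep (B + 1 + 1)) (M₁ : Fin m₁ → (Fin (B + 1) → ℚ) × ℚ),
      s₁.domain ⊆ s.domain → s₁.domain = gDom B 1 m₁ M₁ (fun _ => Sum.inr u) (fun _ => Sum.inr v) →
      s₁.integrand = s.integrand →
      (∀ z : Fin (B + 1 + 1) → ℝ, (∀ j, 0 < affF B 1 (M₁ j) z) → ∀ j, 0 < affF B 1 (M j) z) →
      (∀ z : Fin (B + 1 + 1) → ℝ, (∀ j, 0 < affF B 1 (M₁ j) z) → |affF B 1 Φ z| ≤ |affF B 1 κ z|) →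
      ∃ c ∈ AddSubgroup.closure S, KZ.of s₁ - c ∈ KZ.relations)
    (hB : ∀ (m₁ : ℕ) (s₁ : KZ.IntegralRep (B + 1 + 1)) (M₁ : Fin m₁ → (Fin (B + 1) → ℚ) × ℚ),
      s₁.domain ⊆ s.domain → s₁.domain = gDom B 1 m₁ M₁ (fun _ => Sum.inr u) (fun _ => Sum.inr v) →
      s₁.integrand = s.integrand →
      (∀ z : Fin (B + 1 + 1) → ℝ, (∀ j, 0 < affF B 1 (M₁ j) z) → ∀ j, 0 < affF B 1 (M j) z) →
      (∀ z : Fin (B + 1 + 1) → ℝ, (∀ j, 0 < affF B 1 (M₁ j) z) → |affF B 1 κ z| < |affF B 1 Φ z|) →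
      ∃ c ∈ AddSubgroup.closure S, KZ.of s₁ - c ∈ KZ.relations) :
    ∃ c ∈ AddSubgroup.closure S, KZ.of s - c ∈ KZ.relations := by
  -- degenerate walls
  by_cases hp : κ - Φ = 0
  · obtain rfl : κ = Φ := sub_eq_zero.1 hp
    exact hA m' s M subset_rfl hdom rfl (fun z hz => hz) fun z _ => le_rfl
  by_cases hm : κ + Φ = 0
  · have hΦ : Φ = -κ := by rw [add_eq_zero_iff_eq_neg] at hm; rw [hm, neg_neg]
    exact hA m' s M subset_rfl hdom rfl (fun z hz => hz) fun z _ => by rw [hΦ, affF_neg', abs_neg]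
  -- cut by `κ - Φ`
  obtain ⟨s₁, s₂, hm₁, hm₂, hi₁, hi₂, hd₁, hd₂, hrel⟩ := cutBase s M _ _ hdom (κ - Φ) hp
  have hsub₁ : s₁.domain ⊆ s.domain := fun z hz => ((hm₁ z).1 hz).1
  have hsub₂ : s₂.domain ⊆ s.domain := fun z hz => ((hm₂ z).1 hz).1
  refine good_of_split hrel ?_ ?_
  · -- `Φ < κ`: cut by `κ + Φ`
    obtain ⟨s₃, s₄, hm₃, hm₄, hi₃, hi₄, hd₃, hd₄, hrel'⟩ := cutBase s₁ (Fin.snoc M (κ - Φ)) _ _ hd₁ (κ + Φ) hm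
    have hsub₃ : s₃.domain ⊆ s.domain := fun z hz => hsub₁ ((hm₃ z).1 hz).1
    have hsub₄ : s₄.domain ⊆ s.domain := fun z hz => hsub₁ ((hm₄ z).1 hz).1
    refine good_of_split hrel' ?_ ?_
    · refine hA _ s₃ _ hsub₃ hd₃ (by rw [hi₃, hi₁]) (fun z hz => (rows_snoc (rows_snoc hz).1).1) fun z hz => ?_
      obtain ⟨hz', h2⟩ := rows_snoc hz
      obtain ⟨-, h1⟩ := rows_snoc hz'
      rw [affF_sub'] at h1
      rw [affF_addW] at h2
      rw [abs_of_pos (show 0 < affF B 1 κ z by linarith)]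
      exact (abs_lt.2 ⟨by linarith, by linarith⟩).le
    · refine hB _ s₄ _ hsub₄ hd₄ (by rw [hi₄, hi₁]) (fun z hz => (rows_snoc (rows_snoc hz).1).1) fun z hz => ?_
      obtain ⟨hz', h2⟩ := rows_snoc hz
      obtain ⟨-, h1⟩ := rows_snoc hz'
      rw [affF_sub'] at h1
      rw [affF_neg', affF_addW] at h2
      rw [abs_of_neg (show affF B 1 Φ z < 0 by linarith)]
      exact abs_lt.2 ⟨by linarith, by linarith⟩
  · -- `κ < Φ`: cut by `κ + Φ`
    obtain ⟨s₃, s₄, hm₃, hm₄, hi₃, hi₄, hd₃, hd₄, hrel'⟩ := cutBase s₂ (Fin.snoc M (-(κ - Φ))) _ _ hd₂ (κ + Φ) hm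
    have hsub₃ : s₃.domain ⊆ s.domain := fun z hz => hsub₂ ((hm₃ z).1 hz).1
    have hsub₄ : s₄.domain ⊆ s.domain := fun z hz => hsub₂ ((hm₄ z).1 hz).1
    refine good_of_split hrel' ?_ ?_
    · refine hB _ s₃ _ hsub₃ hd₃ (by rw [hi₃, hi₂]) (fun z hz => (rows_snoc (rows_snoc hz).1).1) fun z hz => ?_
      obtain ⟨hz', h2⟩ := rows_snoc hz
      obtain ⟨-, h1⟩ := rows_snoc hz'
      rw [affF_neg', affF_sub'] at h1
      rw [affF_addW] at h2
      rw [abs_of_pos (show 0 < affF B 1 Φ z by linarith)]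
      exact abs_lt.2 ⟨by linarith, by linarith⟩
    · refine hA _ s₄ _ hsub₄ hd₄ (by rw [hi₄, hi₂]) (fun z hz => (rows_snoc (rows_snoc hz).1).1) fun z hz => ?_
      obtain ⟨hz', h2⟩ := rows_snoc hz
      obtain ⟨-, h1⟩ := rows_snoc hz'
      rw [affF_neg', affF_sub'] at h1
      rw [affF_neg', affF_addW] at h2
      rw [abs_of_neg (show affF B 1 κ z < 0 by linarith)]
      exact (abs_lt.2 ⟨by linarith, by linarith⟩).le

/-- At a corner of a band on whose closed base cell `|Φ| ≤ |κ|`, `Φ = (v − u)(x', ℓ₂)`, the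
corner lies on the pole hyperplane `y = ℓ₂(x')`. -/
theorem corner_on_pole (u v κ : (Fin (B + 1) → ℚ) × ℚ) (ℓ₂ : (Fin B → ℚ) × ℚ)
    (hφ : (v - u).1 (Fin.last B) ≠ 0) (z : Fin (B + 1 + 1) → ℝ)
    (hreg : |affF B 1 (((Fin.snoc (((restr B v - restr B u) + (v.1 (Fin.last B) - u.1 (Fin.last B)) • ℓ₂)).1 0 : Fin (B + 1) → ℚ), (((restr B v - restr B u) + (v.1 (Fin.last B) - u.1 (Fin.last B)) • ℓ₂)).2) : (Fin (B + 1) → ℚ) × ℚ) z| ≤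
      |affF B 1 κ z|)
    (hκ : affF B 1 κ z = 0) (hu : affF B 1 u z = 0) (hv : affF B 1 v z = 0) :
    z (Fin.castAdd 1 (Fin.last B)) = affB B 1 ℓ₂ z := by
  rw [hκ, abs_zero] at hreg
  have hΦ := abs_nonpos_iff.mp hreg
  rw [affF_liftB, affB_addYT, affB_sub, affB_smul'] at hΦ
  rw [affF_split] at hu hv
  rw [Prod.fst_sub, Pi.sub_apply] at hφ
  have hφ' : ((v.1 (Fin.last B) : ℚ) : ℝ) - (u.1 (Fin.last B) : ℝ) ≠ 0 := by
    have h : ((v.1 (Fin.last B) - u.1 (Fin.last B) : ℚ) : ℝ) ≠ 0 := by exact_mod_cast hφ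
    push_cast at h
    exact h
  push_cast at hΦ
  have key : ((v.1 (Fin.last B) : ℝ) - (u.1 (Fin.last B) : ℝ)) * (z (Fin.castAdd 1 (Fin.last B)) - affB B 1 ℓ₂ z) = 0 := by
    linarith
  rcases mul_eq_zero.1 key with h | h
  · exact absurd h hφ'
  · linarith

variable (L : Fin m → (Fin B → ℚ) × ℚ) (e : Fin m → ℕ) (ℓ₁ ℓ₂ : (Fin B → ℚ) × ℚ) (n₁ n₂ : ℕ)

/-- **`Hthick` on a piece with `|Φ| ≤ |κ|`.** Either the closed base cell has no corner (thick
band by compactness, `good_thick_of_noCorner₂`) or its corners are double (`corner_on_pole`)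
and the double-corner hypothesis applies. -/
theorem good_thick_le (s : KZ.IntegralRep (B + 1 + 1)) (M : Fin m' → (Fin (B + 1) → ℚ) × ℚ)
    (p : MvPolynomial (Fin B) ℚ) (u v κ : (Fin (B + 1) → ℚ) × ℚ) (A : ℚ)
    (h12 : n₁ = 0 ∨ n₂ = 0) (hbd : Bornology.IsBounded s.domain)
    (hdom : s.domain = gDom B 1 m' M (fun _ => Sum.inr u) (fun _ => Sum.inr v))
    (hint : EqOn s.integrand (glit B 1 p L e ℓ₁ ℓ₂ n₁ n₂ (fun _ => some 0)) s.domain)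
    (hκ : κ.1 (Fin.last B) = 0) (hA : u - κ = A • (v - u)) (hA0 : 0 < A) (hφ : (v - u).1 (Fin.last B) ≠ 0)
    (hcell : ∀ z : Fin (B + 1 + 1) → ℝ, (∀ j, 0 < affF B 1 (M j) z) →
      affF B 1 κ z < 0 ∧ 0 < affF B 1 u z ∧ affF B 1 u z < affF B 1 v z)
    (hreg : ∀ z : Fin (B + 1 + 1) → ℝ, (∀ j, 0 < affF B 1 (M j) z) →
      |affF B 1 (((Fin.snoc (((restr B v - restr B u) + (v.1 (Fin.last B) - u.1 (Fin.last B)) • ℓ₂)).1 0 : Fin (B + 1) → ℚ), (((restr B v - restr B u) + (v.1 (Fin.last B) - u.1 (Fin.last B)) • ℓ₂)).2) : (Fin (B + 1) → ℚ) × ℚ) z| ≤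
        |affF B 1 κ z|)
    (Hdthick : ∀ (m' : ℕ) (s : KZ.IntegralRep (B + 1 + 1)) (M : Fin m' → (Fin (B + 1) → ℚ) × ℚ)
      (p : MvPolynomial (Fin B) ℚ) (u v κ : (Fin (B + 1) → ℚ) × ℚ) (A : ℚ), Bornology.IsBounded s.domain →
      s.domain = gDom B 1 m' M (fun _ => Sum.inr u) (fun _ => Sum.inr v) →
      EqOn s.integrand (glit B 1 p L e ℓ₁ ℓ₂ n₁ n₂ (fun _ => some 0)) s.domain →
      κ.1 (Fin.last B) = 0 → u - κ = A • (v - u) → 0 < A →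
      (∀ z : Fin (B + 1 + 1) → ℝ, (∀ j, 0 < affF B 1 (M j) z) →
        affF B 1 κ z < 0 ∧ 0 < affF B 1 u z ∧ affF B 1 u z < affF B 1 v z) →
      (∃ z ∈ closure {z : Fin (B + 1 + 1) → ℝ | ∀ j, 0 < affF B 1 (M j) z},
        affF B 1 κ z = 0 ∧ affF B 1 u z = 0 ∧ affF B 1 v z = 0 ∧
        z (Fin.castAdd 1 (Fin.last B)) = affB B 1 ℓ₂ z) →
      ∃ c ∈ AddSubgroup.closure (GGset B 2 1), KZ.of s - c ∈ KZ.relations) :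
    ∃ c ∈ AddSubgroup.closure (GGset B 2 1), KZ.of s - c ∈ KZ.relations := by
  by_cases hc : ∃ z ∈ closure {z : Fin (B + 1 + 1) → ℝ | ∀ j, 0 < affF B 1 (M j) z},
      affF B 1 κ z = 0 ∧ affF B 1 u z = 0 ∧ affF B 1 v z = 0
  · obtain ⟨z, hz, hκ0, hu0, hv0⟩ := hc
    have hregc := le_of_closure_rows ((continuous_affF _).abs) ((continuous_affF κ).abs) hreg z hz
    exact Hdthick m' s M p u v κ A hbd hdom hint hκ hA hA0 hcell
      ⟨z, hz, hκ0, hu0, hv0, corner_on_pole u v κ ℓ₂ hφ z hregc hκ0 hu0 hv0⟩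
  · push Not at hc
    exact good_thick_of_noCorner₂ L e ℓ₁ ℓ₂ n₁ n₂ s M p u v κ A h12 hbd hdom hint hA hA0 hcell
      fun z hz h1 h2 h3 => hc z hz h1 h2 h3

/-- **`Hfar` on a piece with `|Φ| ≤ |κ|`.** As `good_thick_le`. -/
theorem good_far_le (s : KZ.IntegralRep (B + 1 + 1)) (M : Fin m' → (Fin (B + 1) → ℚ) × ℚ)
    (p : MvPolynomial (Fin B) ℚ) (u v κ : (Fin (B + 1) → ℚ) × ℚ) (A : ℚ)
    (h12 : n₁ = 0 ∨ n₂ = 0) (hbd : Bornology.IsBounded s.domain)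
    (hdom : s.domain = gDom B 1 m' M (fun _ => Sum.inr u) (fun _ => Sum.inr v))
    (hint : EqOn s.integrand (glit B 1 p L e ℓ₁ ℓ₂ n₁ n₂ (fun _ => some 0)) s.domain)
    (hκ : κ.1 (Fin.last B) = 0) (hA : u - κ = A • (v - u)) (hA0 : 0 < A) (hφ : (v - u).1 (Fin.last B) ≠ 0)
    (hcell : ∀ z : Fin (B + 1 + 1) → ℝ, (∀ j, 0 < affF B 1 (M j) z) →
      0 < affF B 1 κ z ∧ affF B 1 u z < affF B 1 v z ∧ 2 * affF B 1 κ z ≤ affF B 1 v z)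
    (hreg : ∀ z : Fin (B + 1 + 1) → ℝ, (∀ j, 0 < affF B 1 (M j) z) →
      |affF B 1 (((Fin.snoc (((restr B v - restr B u) + (v.1 (Fin.last B) - u.1 (Fin.last B)) • ℓ₂)).1 0 : Fin (B + 1) → ℚ), (((restr B v - restr B u) + (v.1 (Fin.last B) - u.1 (Fin.last B)) • ℓ₂)).2) : (Fin (B + 1) → ℚ) × ℚ) z| ≤
        |affF B 1 κ z|)
    (Hdfar : ∀ (m' : ℕ) (s : KZ.IntegralRep (B + 1 + 1)) (M : Fin m' → (Fin (B + 1) → ℚ) × ℚ)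
      (p : MvPolynomial (Fin B) ℚ) (u v κ : (Fin (B + 1) → ℚ) × ℚ) (A : ℚ), Bornology.IsBounded s.domain →
      s.domain = gDom B 1 m' M (fun _ => Sum.inr u) (fun _ => Sum.inr v) →
      EqOn s.integrand (glit B 1 p L e ℓ₁ ℓ₂ n₁ n₂ (fun _ => some 0)) s.domain →
      κ.1 (Fin.last B) = 0 → u - κ = A • (v - u) → 0 < A →
      (∀ z : Fin (B + 1 + 1) → ℝ, (∀ j, 0 < affF B 1 (M j) z) →
        0 < affF B 1 κ z ∧ affF B 1 u z < affF B 1 v z ∧ 2 * affF B 1 κ z ≤ affF B 1 v z) →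
      (∃ z ∈ closure {z : Fin (B + 1 + 1) → ℝ | ∀ j, 0 < affF B 1 (M j) z},
        affF B 1 κ z = 0 ∧ affF B 1 u z = 0 ∧ affF B 1 v z = 0 ∧
        z (Fin.castAdd 1 (Fin.last B)) = affB B 1 ℓ₂ z) →
      ∃ c ∈ AddSubgroup.closure (GGset B 2 1), KZ.of s - c ∈ KZ.relations) :
    ∃ c ∈ AddSubgroup.closure (GGset B 2 1), KZ.of s - c ∈ KZ.relations := by
  by_cases hc : ∃ z ∈ closure {z : Fin (B + 1 + 1) → ℝ | ∀ j, 0 < affF B 1 (M j) z},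
      affF B 1 κ z = 0 ∧ affF B 1 u z = 0 ∧ affF B 1 v z = 0
  · obtain ⟨z, hz, hκ0, hu0, hv0⟩ := hc
    have hregc := le_of_closure_rows ((continuous_affF _).abs) ((continuous_affF κ).abs) hreg z hz
    exact Hdfar m' s M p u v κ A hbd hdom hint hκ hA hA0 hcell
      ⟨z, hz, hκ0, hu0, hv0, corner_on_pole u v κ ℓ₂ hφ z hregc hκ0 hu0 hv0⟩
  · push Not at hc
    exact good_far_of_noCorner₂ L e ℓ₁ ℓ₂ n₁ n₂ s M p u v κ A h12 hbd hdom hint hA hA0 hcell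
      fun z hz h1 h2 h3 => hc z hz h1 h2 h3

end Walls

end RebasePos

/-- **Registered part of `stub_rebaseSimplePosOne` (line `janus-bands`, v6.2): the pre-cut of a
band by the walls `κ = ±Φ`** (`RebasePos.good_of_walls`, rule 1a): a representation with literal
domain `{rows, u < t < v}` is good as soon as its sub-cells on which `|Φ| ≤ |κ|` and those on
which `|κ| < |Φ|` are. -/
theorem rebaseSimplePos_goodOfWalls (B m' : ℕ) (S : Set KZ.FormalRep) (s : KZ.IntegralRep (B + 1 + 1)) (M : Fin m' → (Fin (B + 1) → ℚ) × ℚ) (u v κ Φ : (Fin (B + 1) → ℚ) × ℚ) (hdom : s.domain = SeparatePos.gDom B 1 m' M (fun _ => Sum.inr u) (fun _ => Sum.inr v)) (hA : ∀ (m₁ : ℕ) (s₁ : KZ.IntegralRep (B + 1 + 1)) (M₁ : Fin m₁ → (Fin (B + 1) → ℚ) × ℚ), s₁.domain ⊆ s.domain → s₁.domain = SeparatePos.gDom B 1 m₁ M₁ (fun _ => Sum.inr u) (fun _ => Sum.inr v) → s₁.integrand = s.integrand → (∀ z : Fin (B + 1 + 1) → ℝ, (∀ j, 0 < SeparatePos.affF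 B 1 (M₁ j) z) → ∀ j, 0 < SeparatePos.affF B 1 (M j) z) → (∀ z : Fin (B + 1 + 1) → ℝ, (∀ j, 0 < SeparatePos.affF B 1 (M₁ j) z) → |SeparatePos.affF B 1 Φ z| ≤ |SeparatePos.affF B 1 κ z|) → ∃ c ∈ AddSubgroup.closure S, KZ.of s₁ - c ∈ KZ.relations) (hB : ∀ (m₁ : ℕ) (s₁ : KZ.IntegralRep (B + 1 + 1)) (M₁ : Fin m₁ → (Fin (B + 1) → ℚ) × ℚ), s₁.domain ⊆ s.domain → s₁.domain = SeparatePos.gDom B 1 m₁ M₁ (fun _ => Sum.inr u) (fun _ => Sum.inr v) → s₁.integrand = s.integrand → (∀ z : Fin (B + 1 + 1) → ℝ, (∀ j, 0 < SeparatePos.affF B 1 (M₁ j) z) → ∀ j, 0 < SeparatePos.affF B 1 (M j) z) → (∀ z : Fin (B + 1 + 1) → ℝ, (∀ j, 0 < SeparatePos.affF B 1 (M₁ j) z) → |SeparatePos.affF B 1 κ z| < |SeparatePos.affF B 1 Φ z|) → ∃ c ∈ AddSubgroup.closure S, KZ.of s₁ - c ∈ KZ.relations) : ∃ c ∈ AddSubgroup.closure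 S, KZ.of s - c ∈ KZ.relations :=
  RebasePos.good_of_walls s M u v κ Φ hdom hA hB

end Summit.KontsevichZagierPeriods.ArrangementNormalForm.JanusBands
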